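import Summits.QuantumFields.BalabanUV.Beta.CompositeCorrectorRules
import Summits.QuantumFields.BalabanUV.Beta.CompositeCorrectorKernelSpr
import Summits.QuantumFields.BalabanUV.Beta.RelInvCompositeSocket

/-!
# `BalabanUV.Beta.RelInvComposite` — binder row D1, work item K-U3d leaf L4: **THE (Z)_m END** — the composite one-shot dressing (a1*)_m inherits the four relative-inverse
# rules: `RelInv (Ψ̂_m ∘ coDressKBmAt (toSite s) (L^m) (KInv (L^m)) ∘ Ψ̂_mᵀ) (bhKcomp r L m) (axEc (toSite s) (L^m))` with `bhKcomp r L m := Φ̂_mᵀ ∘ bhK (L^m) ∘ Φ̂_m` DEFINED BY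
# CONGRUENCE (row-D1 OWNER an2-g24's K-U3d LEAVES v1 §L4 + ADDENDUM journal l.24201), from the owner's L4a socket `RelInvCompositeSocket.relInv_composite_of_corrector` (p243476)
# fed BY NAME with leaf-06-g32's L2 `spr_psiK ∕ spr_phiK` and leaf-09-g39's L3 `comp_psiK_phiK ∕ comp_phiK_psiK ∕ comp_comp_axEc_psiK ∕ comp_comp_axEc_phiK` — NOTHING ELSE
# (β sub-cell, BINDER-OWNERS row D1; instantiation by the cross-lane idle seat `b2b-balaban-t4-ne9-formalise-leaf-09` gen 39)

HONEST FRAMING (cell charter, verbatim): «discharging BetaPertH makes Balaban's UV stability UNCONDITIONAL — a real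
constructive-QFT result; it is NOT the continuum limit and NOT the Clay problem.»
HONEST DEPENDENCY: continuum YM on T⁴ ⇐ BetaPertH ∧ nine spine estimates (0/9 proved); BetaPertH ⇐ (D1) ∧ (D4) ∧ CAP+tail;
G-an2-4 gates asym, D1 and NE2/3/4.
ABSOLUTE RULE (cell, verbatim): «No internally-minted statement may enter as a cited fact. Every hypothesis is either kernel-proved in this
package or a verbatim quotation of a PUBLISHED theorem with page reference. The manuscript(s) under audit are NOT citable for their own
disputed steps — they are the thing under adjudication; programme-internal (2001/route/tribunal) claims are never citable.»
NOTHING below is cited: no `[cite: …]`, no `Prop` fact; ONE [our object] data definition (`bhKcomp`, by congruence) and [folklore] composition BY NAME.  It asserts nothing about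
Bałaban's non-linear averages beyond their typed linearisations; it is the (Z)_m instance of the row's relative-inverse bookkeeping, NOT (T′)∕(S)∕(R)∕(I), NOT D1.

WHAT (`d+1` the lattice dimension; `0 < L`, `m` levels, `n = L^m`, `[NeZero (L^m)]`; roots `r k ∈ box (d+1) L`; slice root `s ∈ box (d+1) (L^m)`):
[our object] **`bhKcomp r L m := comp (comp (trK (phiK r L m)) (bhK (L^m))) (phiK r L m)`** (its blocks are READ by leaf L4b `CompositeCorrectorBordered`, BY NAME — d1-formalise-ref I-d1ref33-2);
[folklore] **`relInv_composite (hL) (r) (hr) (hs) : RelInv (comp (comp (psiK r L m) (coDressKBmAt (toSite s) (L^m) (KInv (N := L^m)))) (trK (psiK r L m))) (bhKcomp r L m) (axEc (toSite s) (L^m))`**.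
Provenance: β sub-cell; cross-lane idle seat `b2b-balaban-t4-ne9-formalise-leaf-09` gen 39 (prover-b2b-balaban-t4-ne9-formalise-leaf-09-g39-0), 2026-08-21.  NOT (SDF), NOT D1, NOT `BetaPertH`,
NOT continuum, NOT Clay.
-/

noncomputable section

namespace Summit.QuantumFields.BalabanUV.Beta.RelInvComposite

open Literature.MathematicalPhysics.QuantumFieldTheory.Balaban1983to89.Beta
open ExpKernelCalculus (MKer comp)
open AffineAveraging (box toSite)
open OneStepResolventKernel (Fib KInv)
open Summit.QuantumFields.BalabanUV.Beta.TameKernelCalculus (Spr trK)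
open Summit.QuantumFields.BalabanUV.Beta.ChartConjugationRelative (RelInv)
open Summit.QuantumFields.BalabanUV.Beta.AxialDressingRooted (axEc coDressKBmAt)
open Summit.QuantumFields.BalabanUV.Beta.BorderedHessian (bhK)
open Summit.QuantumFields.BalabanUV.Beta.CompositeCorrectorKernel (psiK phiK spr_psiK spr_phiK)
open Summit.QuantumFields.BalabanUV.Beta.CompositeCorrectorRules (comp_psiK_phiK comp_phiK_psiK comp_comp_axEc_psiK comp_comp_axEc_phiK)
open Summit.QuantumFields.BalabanUV.Beta.RelInvCompositeSocket (relInv_composite_of_corrector')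

variable {d : ℕ}

/-- [our object] **THE RE-LINEARISED BORDERED OPERATOR OF THE COMPOSITE DRESSING, BY CONGRUENCE**: `bhKcomp r L m := Φ̂_mᵀ ∘ bhK (L^m) ∘ Φ̂_m` (row-D1 owner's ADDENDUM
l.24201; its four blocks are the theorems `CompositeCorrectorBordered.trK_phiK_bhK_phiK_inl_inl ∕ _inr_inl ∕ _inl_inr ∕ _inr_inr`). -/
def bhKcomp (r : ℕ → (Fin (d + 1) → ℕ)) (L m : ℕ) : MKer (d + 1) (Fib d) :=
  comp (comp (trK (phiK r L m)) (bhK (L ^ m))) (phiK r L m)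

/-- [folklore] Unfolding of `bhKcomp`. -/
theorem bhKcomp_eq (r : ℕ → (Fin (d + 1) → ℕ)) (L m : ℕ) : bhKcomp r L m = comp (comp (trK (phiK r L m)) (bhK (L ^ m))) (phiK r L m) := rfl

/-- [folklore] **THE (Z)_m END OF K-U3d**: the composite-dressed one-shot resolvent `Ψ̂_m ∘ coDressKBmAt (toSite s) n (KInv n) ∘ Ψ̂_mᵀ` is a relative inverse of `bhKcomp r L m` on the
range of the coarse axial coordinate projector `axEc (toSite s) n` — the owner's socket `relInv_composite_of_corrector'` with EVERY corrector hypothesis discharged BY NAME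
(`spr_psiK`, `spr_phiK`: L2; the four identities: L3). -/
theorem relInv_composite {L : ℕ} (hL : 0 < L) (r : ℕ → (Fin (d + 1) → ℕ)) (hr : ∀ k, r k ∈ box (d + 1) L) {m : ℕ} {s : Fin (d + 1) → ℕ}
    (hs : s ∈ box (d + 1) (L ^ m)) [NeZero (L ^ m)] :
    RelInv (comp (comp (psiK r L m) (coDressKBmAt (toSite s) (L ^ m) (KInv (N := L ^ m) (d := d)))) (trK (psiK r L m)))
      (bhKcomp r L m) (axEc (toSite s) (L ^ m)) :=
  relInv_composite_of_corrector' hs (spr_psiK hL hr m) (spr_phiK hL hr m) (comp_psiK_phiK hL r hr m) (comp_phiK_psiK hL r hr m)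
    (comp_comp_axEc_psiK r L m hs) (comp_comp_axEc_phiK r L m hs) (bhKcomp_eq r L m)

end Summit.QuantumFields.BalabanUV.Beta.RelInvComposite

end
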